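import Summits.QuantumFields.BalabanUV.Beta.EriceFlowEnclosureCesaroClockHarmonic
import Summits.QuantumFields.BalabanUV.Beta.EriceFlowEnclosureInverseLawAllOrders

/-!
# Beta / EriceFlowEnclosureCesaroClockHarmonicLimit — THE DISCRETE AND THE CONTINUOUS RG-TIME AVERAGES AGREE: along ANY clock sequence
# `n·h_n → L₀ > 0` the CUTOFF AVERAGE of a bounded, continuous, log-Lipschitz M sampled at the couplings equals row L127's HARMONIC SCALE
# AVERAGE at the current coupling up to o(1):
#     **`N⁻¹·Σ_{n<N} M(h_n) − h_N·∫_{h_N}^{c} M(s) s⁻² ds → 0`**   (0 < c < δ)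
# — so gen 35's RG-time average (rows L127–L130, continuous time ∕ harmonic kernel) and gen 36's cutoff average (rows L132–L133, Cesàro over
# the integer cutoffs) are THE SAME NUMBER asymptotically, not merely two averages carrying the same datum (pure [folklore]; by name over
# P2 #53i `sum_harmonic_le` ∕ `integral_div_sq_abs_le`, P2 #53b `logLip_abs` ∕ `clock_tendsto_zero`, Mathlib `Filter.Tendsto.cesaro`).
# (β-flow team, prover 2 = lower ∕ positivity side, unit `b2b-balaban-beta-bflow-p2`, gen 36; module P2 #53j; no Erice sentence occurs)

HONEST FRAMING (page 1 of everything the β sub-cell writes): discharging `BetaPertH` makes Bałaban's UV stability UNCONDITIONAL — a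
real constructive-QFT result; it is NOT the continuum limit and NOT the Clay problem.  HONEST DEPENDENCY (cell reorg 2026-08-19,
verbatim): «continuum YM on T⁴ ⇐ BetaPertH ∧ nine spine estimates (0/9 proved); BetaPertH ⇐ (D1) ∧ (D4) ∧ CAP+tail; G-an2-4 gates
asym, D1 and NE2/3/4.»  THIS MODULE DISCHARGES NOTHING and quotes nothing: [folklore] real analysis (shapes: M = the three-loop Cesàro mean,
h = the cutoff couplings with the two-loop clock of row L119, `t·∫ₜᶜ M s⁻²` = row L127's harmonic average).

THE POINT.  Split `Σ_{n<N} M(h_n) = Σ_{n<n₀} M(h_n) + Σ_{n₀≤n<N} M(L₀∕n) + Σ_{n₀≤n<N} (M(h_n) − M(L₀∕n))`: the last is a Cesàro sum of a NULL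
sequence (`|M(h_n) − M(L₀∕n)| ≤ C·|log(n·h_n∕L₀)| → 0`), the middle is `L₀·∫_{L₀∕N}^{L₀∕n₀} M s⁻² + O(log N)` (P2 #53i), and
`∫_{L₀∕N}^{L₀∕n₀} = ∫_{L₀∕N}^{h_N} + ∫_{h_N}^{c} + ∫_{c}^{L₀∕n₀}` with `|∫_{L₀∕N}^{h_N} M s⁻²| ≤ B·|N∕L₀ − 1∕h_N| = (BN∕L₀)·|1 − L₀∕(N h_N)| = o(N)`;
finally `L₀∕N = h_N·(1 + o(1))` and `|∫_{h_N}^{c} M s⁻²| ≤ B∕h_N`.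

WHAT THIS FILE PROVES (0 sorry, 0 def): `intervalIntegrable_div_sq`, `integral_div_sq_abs_le'`, `cesaro_prefix_null`, `one_add_log_div_nat_tendsto`,
END **`cutoffAverage_sub_harmonic_tendsto_zero`**, and the corollary **`cutoffAverage_iff_harmonic`** (`N⁻¹Σ_{n<N} M(h_n) → m ⟺ h_N·∫_{h_N}^{c} M s⁻² → m`).
NOT CLAIMED: a rate (it is `O(C log N∕N + B·|1 − L₀∕(N h_N)| + Cesàro of C|log(n h_n∕L₀)|)` — not packaged); the β-side by-name junction with
rows L127 ∕ L133 (M = Cesàro mean of r∕u², h = the bare trajectory — a successor line); `BetaPertH`; continuum; Clay.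
-/

namespace Summit.QuantumFields.BalabanUV.Beta.EriceFlowEnclosureCesaroClockHarmonicLimit

open Set Filter Topology Finset MeasureTheory intervalIntegral
open Summit.QuantumFields.BalabanUV.Beta.EriceFlowEnclosureCesaroClockSampling (logLip_abs clock_tendsto_zero)
open Summit.QuantumFields.BalabanUV.Beta.EriceFlowEnclosureCesaroClockHarmonic (sum_harmonic_le integral_div_sq_abs_le)
open Summit.QuantumFields.BalabanUV.Beta.EriceFlowEnclosureInverseLawAllOrders (tendsto_one_add_log_pow_div)

noncomputable section

variable {M : ℝ → ℝ} {δ C B L₀ : ℝ}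

/-! ## §1 Service -/

/-- `s ↦ M(s)∕s²` is interval-integrable between any two points of ]0, δ[ when M is continuous there. [folklore] -/
theorem intervalIntegrable_div_sq (hcont : ContinuousOn M (Ioo 0 δ)) {a b : ℝ} (ha : a ∈ Ioo 0 δ) (hb : b ∈ Ioo 0 δ) :
    IntervalIntegrable (fun s => M s / s ^ 2) volume a b := by
  refine ((hcont.div (continuousOn_id.pow 2) fun s hs => pow_ne_zero 2 hs.1.ne').mono ?_).intervalIntegrable
  intro s hs
  rcases le_total a b with hab | hba
  · rw [uIcc_of_le hab] at hs; exact ⟨ha.1.trans_le hs.1, hs.2.trans_lt hb.2⟩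
  · rw [uIcc_of_ge hba] at hs; exact ⟨hb.1.trans_le hs.1, hs.2.trans_lt ha.2⟩

/-- Symmetric boundary estimate: `|∫ₐᵇ M s⁻²| ≤ B·|a⁻¹ − b⁻¹|` for a, b ∈ ]0, δ[ and |M| ≤ B (P2 #53i `integral_div_sq_abs_le` in either order).
[folklore] -/
theorem integral_div_sq_abs_le' (hB : ∀ s ∈ Ioo 0 δ, |M s| ≤ B) {a b : ℝ} (ha : a ∈ Ioo 0 δ) (hb : b ∈ Ioo 0 δ) :
    |∫ s in a..b, M s / s ^ 2| ≤ B * |a⁻¹ - b⁻¹| := by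
  rcases le_total a b with hab | hba
  · have h := integral_div_sq_abs_le hB ha.1 hab hb.2
    rwa [abs_of_nonneg (sub_nonneg.mpr ((inv_le_inv₀ (ha.1.trans_le hab) ha.1).mpr hab))]
  · have h := integral_div_sq_abs_le hB hb.1 hba ha.2
    rw [intervalIntegral.integral_symm, abs_neg, abs_sub_comm]
    rwa [abs_of_nonneg (sub_nonneg.mpr ((inv_le_inv₀ (hb.1.trans_le hba) hb.1).mpr hba))]

/-- The Cesàro mean of a sequence that is NULL from n₀ on and ZERO before: `N⁻¹·Σ_{n<N} (if n₀ ≤ n then a n else 0) → 0` when `a → 0`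
(Mathlib's `Filter.Tendsto.cesaro`). [folklore] -/
theorem cesaro_prefix_null {a : ℕ → ℝ} {n₀ : ℕ} (ha : Tendsto a atTop (𝓝 0)) :
    Tendsto (fun N : ℕ => (N : ℝ)⁻¹ * ∑ n ∈ range N, (if n₀ ≤ n then a n else 0)) atTop (𝓝 0) := by
  have h : Tendsto (fun n : ℕ => if n₀ ≤ n then a n else 0) atTop (𝓝 0) := by
    refine ha.congr' ?_
    filter_upwards [eventually_ge_atTop n₀] with n hn
    rw [if_pos hn]
  exact h.cesaro

/-- `(1 + log N)∕N → 0` along the integers. [folklore] -/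
theorem one_add_log_div_nat_tendsto : Tendsto (fun N : ℕ => (1 + Real.log (N:ℝ)) / N) atTop (𝓝 0) := by
  have h := (tendsto_one_add_log_pow_div 1).comp tendsto_natCast_atTop_atTop
  refine h.congr fun N => ?_
  simp [Function.comp]

/-! ## §2 The discrete and the continuous RG-time averages agree -/

/-- **END — THE CUTOFF AVERAGE IS THE HARMONIC SCALE AVERAGE AT THE CURRENT COUPLING, UP TO o(1).**  Let M be continuous on ]0, δ[ with
`|M| ≤ B` and `|M u − M t| ≤ C·log(u∕t)` (0 < t ≤ u < δ; C ≥ 0); let `h_n > 0` with the clock `n·h_n → L₀ > 0`; let `0 < c < δ`.  Then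
**`N⁻¹·Σ_{n<N} M(h_n) − h_N·∫_{h_N}^{c} M(s) s⁻² ds → 0`**. [folklore] -/
theorem cutoffAverage_sub_harmonic_tendsto_zero (hδ : 0 < δ) (hC : 0 ≤ C) (hcont : ContinuousOn M (Ioo 0 δ))
    (hlip : ∀ t u : ℝ, 0 < t → t ≤ u → u < δ → |M u - M t| ≤ C * Real.log (u / t))
    (hB : ∀ s ∈ Ioo 0 δ, |M s| ≤ B) {h : ℕ → ℝ} (hpos : ∀ n, 0 < h n) (hL₀ : 0 < L₀)
    (hclock : Tendsto (fun n : ℕ => (n : ℝ) * h n) atTop (𝓝 L₀)) {c : ℝ} (hc0 : 0 < c) (hcδ : c < δ) :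
    Tendsto (fun N : ℕ => (N : ℝ)⁻¹ * ∑ n ∈ range N, M (h n) - h N * ∫ s in (h N)..c, M s / s ^ 2) atTop (𝓝 0) := by
  have hB0 : 0 ≤ B := (abs_nonneg _).trans (hB c ⟨hc0, hcδ⟩)
  -- the threshold n₀: L₀/n₀ < c
  obtain ⟨n₀, hn₀⟩ : ∃ n₀ : ℕ, n₀ = ⌈L₀ / c⌉₊ + 1 := ⟨_, rfl⟩
  have hn₀1 : 1 ≤ n₀ := by omega
  have hn₀pos : (0:ℝ) < n₀ := by exact_mod_cast lt_of_lt_of_le Nat.one_pos hn₀1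
  have hn₀c : L₀ / n₀ < c := by
    rw [div_lt_iff₀ hn₀pos]
    have h1 : L₀ / c ≤ ⌈L₀ / c⌉₊ := Nat.le_ceil _
    have h2 : ((⌈L₀ / c⌉₊ : ℕ) : ℝ) + 1 = n₀ := by rw [hn₀]; push_cast; ring
    rw [div_le_iff₀ hc0] at h1
    nlinarith
  have hn₀δ : L₀ / n₀ < δ := hn₀c.trans hcδ
  have hc₀mem : L₀ / n₀ ∈ Ioo 0 δ := ⟨div_pos hL₀ hn₀pos, hn₀δ⟩
  have hcmem : c ∈ Ioo 0 δ := ⟨hc0, hcδ⟩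
  -- the null sequence a_n := M(h_n) − M(L₀/n)
  have hh0 := clock_tendsto_zero hclock
  have ha : Tendsto (fun n : ℕ => M (h n) - M (L₀ / n)) atTop (𝓝 0) := by
    have hlog : Tendsto (fun n : ℕ => Real.log ((n : ℝ) * h n / L₀)) atTop (𝓝 0) := by
      have h1 := hclock.div_const L₀
      rw [div_self hL₀.ne'] at h1
      have h2 := (Real.continuousAt_log one_ne_zero).tendsto.comp h1
      rwa [Real.log_one] at h2
    have hbound : ∀ᶠ n : ℕ in atTop, |M (h n) - M (L₀ / n)| ≤ C * |Real.log ((n : ℝ) * h n / L₀)| := by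
      filter_upwards [eventually_ge_atTop n₀, hh0.eventually (gt_mem_nhds hδ)] with n hn hnδ
      have hnpos : (0:ℝ) < n := lt_of_lt_of_le hn₀pos (Nat.cast_le.mpr hn)
      have hLn : L₀ / n < δ := lt_of_le_of_lt (div_le_div_of_nonneg_left hL₀.le hn₀pos (Nat.cast_le.mpr hn)) hn₀δ
      have hb := logLip_abs hlip (div_pos hL₀ hnpos) hLn (hpos n) hnδ
      have hq : h n / (L₀ / n) = (n : ℝ) * h n / L₀ := by field_simp
      rwa [hq] at hb
    have hC0 : Tendsto (fun n : ℕ => C * |Real.log ((n : ℝ) * h n / L₀)|) atTop (𝓝 0) := by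
      have := (continuous_abs.tendsto 0).comp hlog
      rw [abs_zero] at this
      have := this.const_mul C
      rwa [mul_zero] at this
    exact squeeze_zero_norm' (by filter_upwards [hbound] with n hn; rw [Real.norm_eq_abs]; exact hn) hC0
  -- the six small terms
  have hx : Tendsto (fun N : ℕ => L₀ / ((N : ℝ) * h N)) atTop (𝓝 1) := by
    have := hclock.inv₀ hL₀.ne' |>.const_mul L₀
    rw [mul_inv_cancel₀ hL₀.ne'] at this
    exact this.congr fun N => by rw [div_eq_mul_inv]
  have hT1 : Tendsto (fun N : ℕ => (N : ℝ)⁻¹ * ∑ n ∈ range n₀, M (h n)) atTop (𝓝 0) := by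
    have := (tendsto_inv_atTop_zero.comp tendsto_natCast_atTop_atTop).mul_const (∑ n ∈ range n₀, M (h n))
    rwa [zero_mul] at this
  have hT2 := cesaro_prefix_null (n₀ := n₀) ha
  have hT3 : Tendsto (fun N : ℕ => C * ((1 + Real.log (N:ℝ)) / N)) atTop (𝓝 0) := by
    have := one_add_log_div_nat_tendsto.const_mul C; rwa [mul_zero] at this
  have hT4 : Tendsto (fun N : ℕ => B * |1 - L₀ / ((N : ℝ) * h N)|) atTop (𝓝 0) := by
    have h1 : Tendsto (fun N : ℕ => 1 - L₀ / ((N : ℝ) * h N)) atTop (𝓝 0) := by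
      have := hx.const_sub 1; rwa [sub_self] at this
    have h2 := (continuous_abs.tendsto 0).comp h1
    rw [abs_zero] at h2
    have := h2.const_mul B; rwa [mul_zero] at this
  have hT5 : Tendsto (fun N : ℕ => (N : ℝ)⁻¹ * (L₀ * ∫ s in c..(L₀ / n₀), M s / s ^ 2)) atTop (𝓝 0) := by
    have := (tendsto_inv_atTop_zero.comp tendsto_natCast_atTop_atTop).mul_const (L₀ * ∫ s in c..(L₀ / n₀), M s / s ^ 2)
    rwa [zero_mul] at this
  have hT6 : Tendsto (fun N : ℕ => B * |L₀ / ((N : ℝ) * h N) - 1|) atTop (𝓝 0) := by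
    refine hT4.congr fun N => ?_
    rw [abs_sub_comm]
  -- the bound |D_N| ≤ T1 + T2 + T3 + T4 + T5 + T6 eventually (as absolute values)
  have hsum := ((((((continuous_abs.tendsto 0).comp hT1).add ((continuous_abs.tendsto 0).comp hT2)).add hT3).add hT4).add
    ((continuous_abs.tendsto 0).comp hT5)).add hT6
  simp only [Function.comp, abs_zero, add_zero] at hsum
  refine squeeze_zero_norm' ?_ hsum
  filter_upwards [eventually_ge_atTop n₀, hh0.eventually (gt_mem_nhds hc0)] with N hN hNc
  have hN1 : 1 ≤ N := hn₀1.trans hN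
  have hNpos : (0:ℝ) < N := Nat.cast_pos.mpr (lt_of_lt_of_le Nat.one_pos hN1)
  have hhN : h N ∈ Ioo 0 δ := ⟨hpos N, hNc.trans hcδ⟩
  have hLN : L₀ / N ∈ Ioo 0 δ :=
    ⟨div_pos hL₀ hNpos, lt_of_le_of_lt (div_le_div_of_nonneg_left hL₀.le hn₀pos (Nat.cast_le.mpr hN)) hn₀δ⟩
  rw [Real.norm_eq_abs]
  -- decomposition of the sum
  have hsplit : ∑ n ∈ range N, M (h n) = ∑ n ∈ range n₀, M (h n) + ∑ n ∈ Finset.Ico n₀ N, M (L₀ / n)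
      + ∑ n ∈ range N, (if n₀ ≤ n then M (h n) - M (L₀ / n) else 0) := by
    rw [← sum_range_add_sum_Ico _ hN, ← sum_range_add_sum_Ico (fun n => if n₀ ≤ n then M (h n) - M (L₀ / ↑n) else 0) hN]
    have hz : ∑ n ∈ range n₀, (if n₀ ≤ n then M (h n) - M (L₀ / ↑n) else 0) = 0 :=
      sum_eq_zero fun n hn => by rw [if_neg (not_le.mpr (mem_range.mp hn))]
    have hI : ∑ n ∈ Finset.Ico n₀ N, (if n₀ ≤ n then M (h n) - M (L₀ / ↑n) else 0)
        = ∑ n ∈ Finset.Ico n₀ N, (M (h n) - M (L₀ / n)) :=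
      sum_congr rfl fun n hn => by rw [if_pos (Finset.mem_Ico.mp hn).1]
    rw [hz, hI, zero_add, sum_sub_distrib]
    ring
  -- the integral splitting: ∫_{L₀/N}^{L₀/n₀} = ∫_{L₀/N}^{h_N} + ∫_{h_N}^{c} + ∫_{c}^{L₀/n₀}
  have hI1 := intervalIntegrable_div_sq hcont hLN hhN
  have hI2 := intervalIntegrable_div_sq hcont hhN hcmem
  have hI3 := intervalIntegrable_div_sq hcont hcmem hc₀mem
  have hsplitI : ∫ s in (L₀ / N)..(L₀ / n₀), M s / s ^ 2
      = (∫ s in (L₀ / N)..(h N), M s / s ^ 2) + (∫ s in (h N)..c, M s / s ^ 2) + ∫ s in c..(L₀ / n₀), M s / s ^ 2 := by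
    rw [intervalIntegral.integral_add_adjacent_intervals hI1 hI2,
      intervalIntegral.integral_add_adjacent_intervals (hI1.trans hI2) hI3]
  -- the estimates
  have hQ := sum_harmonic_le hδ hL₀ hC hcont hlip hn₀1 hn₀δ hN
  have hJ : |∫ s in (L₀ / N)..(h N), M s / s ^ 2| ≤ B * |(L₀ / N)⁻¹ - (h N)⁻¹| := integral_div_sq_abs_le' hB hLN hhN
  have hI : |∫ s in (h N)..c, M s / s ^ 2| ≤ B * ((h N)⁻¹ - c⁻¹) := integral_div_sq_abs_le hB (hpos N) hNc.le hcδ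
  -- rewrite the boundary term: (L₀/N)·B|N/L₀ − 1/h_N| = B|1 − L₀/(N h_N)|
  have hxN : 0 < (N : ℝ) * h N := mul_pos hNpos (hpos N)
  have hJ' : (N : ℝ)⁻¹ * L₀ * (B * |(L₀ / N)⁻¹ - (h N)⁻¹|) = B * |1 - L₀ / ((N : ℝ) * h N)| := by
    have h1 : (L₀ / N)⁻¹ - (h N)⁻¹ = (L₀ / N)⁻¹ * (1 - L₀ / ((N : ℝ) * h N)) := by field_simp
    rw [h1, abs_mul, abs_of_pos (by positivity : (0:ℝ) < (L₀ / N)⁻¹)]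
    field_simp
  have hhNpos : 0 < h N := hpos N
  have hK' : |((N : ℝ)⁻¹ * L₀ - h N) * ∫ s in (h N)..c, M s / s ^ 2| ≤ B * |L₀ / ((N : ℝ) * h N) - 1| := by
    rw [abs_mul]
    have h1 : |(N : ℝ)⁻¹ * L₀ - h N| = h N * |L₀ / ((N : ℝ) * h N) - 1| := by
      have : (N : ℝ)⁻¹ * L₀ - h N = h N * (L₀ / ((N : ℝ) * h N) - 1) := by
        rw [mul_sub, mul_one, mul_div_assoc', mul_comm (h N) L₀, mul_div_mul_right L₀ (N : ℝ) hhNpos.ne',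
          inv_mul_eq_div]
      rw [this, abs_mul, abs_of_pos hhNpos]
    rw [h1]
    have h2 : |∫ s in (h N)..c, M s / s ^ 2| ≤ B * (h N)⁻¹ := hI.trans (by nlinarith [inv_pos.mpr hc0])
    calc h N * |L₀ / (↑N * h N) - 1| * |∫ s in h N..c, M s / s ^ 2|
        ≤ h N * |L₀ / (↑N * h N) - 1| * (B * (h N)⁻¹) := mul_le_mul_of_nonneg_left h2 (by positivity)
      _ = (h N * (h N)⁻¹) * (B * |L₀ / (↑N * h N) - 1|) := by ring
      _ = B * |L₀ / (↑N * h N) - 1| := by rw [mul_inv_cancel₀ hhNpos.ne', one_mul]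
  -- assemble
  have hD : (N : ℝ)⁻¹ * ∑ n ∈ range N, M (h n) - h N * ∫ s in (h N)..c, M s / s ^ 2
      = (N : ℝ)⁻¹ * ∑ n ∈ range n₀, M (h n)
        + (N : ℝ)⁻¹ * ∑ n ∈ range N, (if n₀ ≤ n then M (h n) - M (L₀ / n) else 0)
        + (N : ℝ)⁻¹ * (∑ n ∈ Finset.Ico n₀ N, M (L₀ / n) - L₀ * ∫ s in (L₀ / N)..(L₀ / n₀), M s / s ^ 2)
        + (N : ℝ)⁻¹ * L₀ * (∫ s in (L₀ / N)..(h N), M s / s ^ 2)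
        + (N : ℝ)⁻¹ * (L₀ * ∫ s in c..(L₀ / n₀), M s / s ^ 2)
        + ((N : ℝ)⁻¹ * L₀ - h N) * ∫ s in (h N)..c, M s / s ^ 2 := by
    rw [hsplit, hsplitI]; ring
  rw [hD]
  have hQ' : |(N : ℝ)⁻¹ * (∑ n ∈ Finset.Ico n₀ N, M (L₀ / n) - L₀ * ∫ s in (L₀ / N)..(L₀ / n₀), M s / s ^ 2)|
      ≤ C * ((1 + Real.log (N:ℝ)) / N) := by
    rw [abs_mul, abs_of_pos (inv_pos.mpr hNpos)]
    calc (N : ℝ)⁻¹ * |∑ n ∈ Finset.Ico n₀ N, M (L₀ / n) - L₀ * ∫ s in (L₀ / N)..(L₀ / n₀), M s / s ^ 2|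
        ≤ (N : ℝ)⁻¹ * (C * (1 + Real.log N)) := mul_le_mul_of_nonneg_left hQ (by positivity)
      _ = C * ((1 + Real.log (N:ℝ)) / N) := by rw [div_eq_inv_mul]; ring
  have hJ'' : |(N : ℝ)⁻¹ * L₀ * ∫ s in (L₀ / N)..(h N), M s / s ^ 2| ≤ B * |1 - L₀ / ((N : ℝ) * h N)| := by
    rw [← hJ', abs_mul, abs_of_pos (by positivity : (0:ℝ) < (N : ℝ)⁻¹ * L₀)]
    exact mul_le_mul_of_nonneg_left hJ (by positivity)
  have habs6 : ∀ a₁ a₂ a₃ a₄ a₅ a₆ : ℝ, |a₁ + a₂ + a₃ + a₄ + a₅ + a₆| ≤ |a₁| + |a₂| + |a₃| + |a₄| + |a₅| + |a₆| := by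
    intro a₁ a₂ a₃ a₄ a₅ a₆
    calc |a₁ + a₂ + a₃ + a₄ + a₅ + a₆| ≤ |a₁ + a₂ + a₃ + a₄ + a₅| + |a₆| := abs_add_le _ _
      _ ≤ |a₁ + a₂ + a₃ + a₄| + |a₅| + |a₆| := by linarith [abs_add_le (a₁ + a₂ + a₃ + a₄) a₅]
      _ ≤ |a₁ + a₂ + a₃| + |a₄| + |a₅| + |a₆| := by linarith [abs_add_le (a₁ + a₂ + a₃) a₄]
      _ ≤ |a₁ + a₂| + |a₃| + |a₄| + |a₅| + |a₆| := by linarith [abs_add_le (a₁ + a₂) a₃]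
      _ ≤ |a₁| + |a₂| + |a₃| + |a₄| + |a₅| + |a₆| := by linarith [abs_add_le a₁ a₂]
  refine (habs6 _ _ _ _ _ _).trans ?_
  linarith [hQ', hJ'', hK']

/-- **COROLLARY — ONE NUMBER, TWO CLOCKS**: under the same hypotheses, for every m:
**`N⁻¹·Σ_{n<N} M(h_n) → m ⟺ h_N·∫_{h_N}^{c} M s⁻² → m`** — the cutoff average converges iff row L127's harmonic average converges ALONG THE
COUPLINGS, to the same limit. (Row L127 `harmonic_iff_cesaro` and P2 #53b `cutoffAverage_iff` then say both ⟺ `M → m` at 0⁺.) [folklore] -/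
theorem cutoffAverage_iff_harmonic (hδ : 0 < δ) (hC : 0 ≤ C) (hcont : ContinuousOn M (Ioo 0 δ))
    (hlip : ∀ t u : ℝ, 0 < t → t ≤ u → u < δ → |M u - M t| ≤ C * Real.log (u / t))
    (hB : ∀ s ∈ Ioo 0 δ, |M s| ≤ B) {h : ℕ → ℝ} (hpos : ∀ n, 0 < h n) (hL₀ : 0 < L₀)
    (hclock : Tendsto (fun n : ℕ => (n : ℝ) * h n) atTop (𝓝 L₀)) {c : ℝ} (hc0 : 0 < c) (hcδ : c < δ) (m : ℝ) :
    Tendsto (fun N : ℕ => (N : ℝ)⁻¹ * ∑ n ∈ range N, M (h n)) atTop (𝓝 m) ↔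
      Tendsto (fun N : ℕ => h N * ∫ s in (h N)..c, M s / s ^ 2) atTop (𝓝 m) := by
  have hD := cutoffAverage_sub_harmonic_tendsto_zero hδ hC hcont hlip hB hpos hL₀ hclock hc0 hcδ
  constructor
  · intro h1
    have := h1.sub hD
    rw [sub_zero] at this
    exact this.congr fun N => by ring
  · intro h2
    have := hD.add h2
    rw [zero_add] at this
    exact this.congr fun N => by ring

end

end Summit.QuantumFields.BalabanUV.Beta.EriceFlowEnclosureCesaroClockHarmonicLimit
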